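/-
Copyright: the b2b-balaban cell (near-miss cell 7), T⁴-continuum CRUX team (coordinator ruling e34b3e0c item (2)),
seat t4-ne7b-formalise-leaf-06 (gen 28). Released under the licence of the surrounding project.
-/
import Literature.MathematicalPhysics.QuantumFieldTheory.Balaban1983to89.T4HaarSU2Translate
import Summits.QuantumFields.BalabanUV.T4Continuum.Spine.NE7b.CovariantDivergenceEL

/-!
# The `SU(2) ↔ S³ ⊂ ℍ` bridge for the NE7b sine-curvature chain
# (route NE7b R-H, `t4/ROUTES-NE7b.md` v5 §3 ∕ v6.1 §10 S-k4∕S-k5: «plus the SU(2) ↔ ℍ bridge (unchanged ask)»)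

Cell `pub-balaban`, sub-cell `t4`, spine estimate NE7b (node U5c). This lineage's PH-k chain ((β₁)–(β₄), (γ), (δ),
(T-k5), (L1): `QuaternionBianchiDefect`, `CovariantDivergenceEL`, `CovariantMeanValueInequality`, `LatticeSubsolutionBarrier`,
`SineCurvatureMaximumPrinciple`, `MinimiserMaximumPrinciple`, `EnergyQuantumLemma`, …) is typed over configurations
`ZdGaugeConfig d (Metric.sphere (0 : ℍ) 1)` with values in the UNIT QUATERNIONS, while the cell's Bałaban files speak of
`SU2 = Matrix.specialUnitaryGroup (Fin 2) ℂ`. The element-level dictionary already exists in the tree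
(`QuantumLattice.SU2Haar`: `quatMatrix`, `su2Quat`, `quatToSU2`; `Balaban1983to89.T4HaarSU2Translate`: `su2Quat_mul`,
`su2Quat_one`, `su2Quat_quatToSU2`). THIS FILE packages it for configurations, BY NAME, with no new mathematics:

* **`su2SphereEquiv : SU(2) ≃* S³`** — the multiplicative equivalence `U ↦ su2Quat U` (first row of `U` read as a
  unit quaternion), inverse `quatToSU2`;
* **`toSphereConfig`** — transport of a configuration `ZdGaugeConfig d SU(2) → ZdGaugeConfig d S³` link by link, with
  **`plaquette_toSphereConfig`**: plaquette holonomies correspond under `su2SphereEquiv` (it is a group hom);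
* **`re_trace_su2_eq_two_mul_re`**: `Re tr U = 2·re(su2Quat U)`, hence **`wilsonPlaquette_eq`**: the Wilson plaquette
  action `1 − ½ Re tr U_p` of the `SU(2)` configuration IS `1 − re q_p` of the transported one, and
  **`norm_curv_sq_eq`**: the sine-curvature of the chain satisfies `‖E_p‖² = 1 − (½ Re tr U_p)²` (`= sin²θ_p`).

So every statement of the chain about `toSphereConfig U` is a statement about the `SU(2)` configuration `U`, its
Wilson action and its plaquette traces; criticality ∕ minimality notions transfer through the bijection link by link.

HONEST FRAMING. Bookkeeping only; nothing of [Bałaban 1983–89] asserted or cited. NE7b (`T4WeightBudget.RelWeightBound`)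
NOT PRINTED and NOT PROVED; spine PROVED 0∕9; rung (B)+1 on a FINITE torus T⁴ — NOT infinite volume, NOT the mass gap,
NOT Clay. HONEST DEPENDENCY: continuum YM on T⁴ ⇐ BetaPertH ∧ nine spine estimates (0/9 proved); BetaPertH ⇐ (D1) ∧ (D4)
∧ CAP+tail; G-an2-4 gates asym, D1 and NE2/3/4. POLICY: crux-route work under `Spine/NE7b/` (ROUTES v6 §10), not a
`T4Continuum/Support` leaf (FREEZE (0) respected); two concrete definitions (`su2SphereEquiv`, `toSphereConfig`), no
`Prop`-valued fact, no `[cite:]` fact, no notation.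
-/

set_option autoImplicit false

noncomputable section

namespace Summit.QuantumFields.BalabanUV.T4Continuum.NE7b.SU2QuaternionBridge

open scoped Quaternion
open Literature.MathematicalPhysics.QuantumFieldTheory (ZdEdge ZdGaugeConfig)
open Literature.Probability.LatticeModels (Site)
open Literature.MathematicalPhysics.QuantumLattice (quatMatrix su2Quat norm_su2Quat quatToSU2 quatToSU2_su2Quat
  quatMatrix_su2Quat quatMatrix_apply_00 quatMatrix_apply_11)
open Literature.MathematicalPhysics.QuantumFieldTheory.Balaban1983to89.T4HaarSU2Translate (su2Quat_mul su2Quat_quatToSU2)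
open Summit.QuantumFields.BalabanUV.T4Continuum.NE7b.CovariantDivergenceEL (curv)

variable {d : ℕ}

/-! ## §1 The group isomorphism `SU(2) ≃* S³` -/

/-- **`SU(2) ≃* S³`**: `U ↦ su2Quat U` (the first row `(U₀₀, U₀₁) = (z, w)` read as the unit quaternion `z + w·j`),
with inverse the tree's `quatToSU2`; multiplicative by `T4HaarSU2Translate.su2Quat_mul`. -/
def su2SphereEquiv : Matrix.specialUnitaryGroup (Fin 2) ℂ ≃* Metric.sphere (0 : ℍ) 1 where
  toFun U := ⟨su2Quat U, by rw [mem_sphere_zero_iff_norm, norm_su2Quat]⟩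
  invFun q := quatToSU2 (q : ℍ)
  left_inv U := quatToSU2_su2Quat U
  right_inv q := by
    apply Subtype.ext
    have hq : ‖(q : ℍ)‖ = 1 := mem_sphere_zero_iff_norm.mp q.2
    have hq0 : (q : ℍ) ≠ 0 := fun h => by rw [h, norm_zero] at hq; exact zero_ne_one hq
    show su2Quat (quatToSU2 (q : ℍ)) = q
    rw [su2Quat_quatToSU2 hq0, hq, inv_one, one_smul]
  map_mul' U W := Subtype.ext (su2Quat_mul U W)

/-- The underlying quaternion of `su2SphereEquiv U` is `su2Quat U`. -/
@[simp] theorem coe_su2SphereEquiv (U : Matrix.specialUnitaryGroup (Fin 2) ℂ) :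
    ((su2SphereEquiv U : Metric.sphere (0 : ℍ) 1) : ℍ) = su2Quat U := rfl

/-- **`Re tr U = 2·re(su2Quat U)`** for `U ∈ SU(2)` (`U = quatMatrix (su2Quat U) = [[z, w], [−w̄, z̄]]`). -/
theorem re_trace_su2_eq_two_mul_re (U : Matrix.specialUnitaryGroup (Fin 2) ℂ) :
    ((U : Matrix (Fin 2) (Fin 2) ℂ).trace).re = 2 * (su2Quat U).re := by
  rw [← quatMatrix_su2Quat U, Matrix.trace_fin_two, quatMatrix_apply_00, quatMatrix_apply_11, Complex.add_re]
  ring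

/-! ## §2 Transport of configurations and the plaquette dictionary -/

/-- Link-by-link transport of an `SU(2)` configuration on `ℤ^d` to a unit-quaternion configuration. -/
def toSphereConfig (U : ZdGaugeConfig d (Matrix.specialUnitaryGroup (Fin 2) ℂ)) :
    ZdGaugeConfig d (Metric.sphere (0 : ℍ) 1) :=
  fun b => su2SphereEquiv (U b)

/-- The transport is a bijection on configurations (inverse: compose with `su2SphereEquiv.symm`). -/
theorem toSphereConfig_injective : Function.Injective (toSphereConfig (d := d)) := fun U V h => by
  funext b
  exact su2SphereEquiv.injective (congrFun h b)

/-- Every unit-quaternion configuration is the transport of an `SU(2)` configuration. -/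
theorem toSphereConfig_surjective : Function.Surjective (toSphereConfig (d := d)) := fun V =>
  ⟨fun b => su2SphereEquiv.symm (V b), funext fun b => su2SphereEquiv.apply_symm_apply (V b)⟩

/-- **PLAQUETTES CORRESPOND**: `P_{ij}(x)[toSphereConfig U] = su2SphereEquiv (P_{ij}(x)[U])`. -/
theorem plaquette_toSphereConfig (U : ZdGaugeConfig d (Matrix.specialUnitaryGroup (Fin 2) ℂ)) (x : Site d) (i j : Fin d) :
    ZdGaugeConfig.plaquette (toSphereConfig U) x i j = su2SphereEquiv (ZdGaugeConfig.plaquette U x i j) := by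
  simp only [ZdGaugeConfig.plaquette, toSphereConfig, map_mul, map_inv]

/-- The quaternion of the transported plaquette is `su2Quat` of the `SU(2)` plaquette. -/
theorem coe_plaquette_toSphereConfig (U : ZdGaugeConfig d (Matrix.specialUnitaryGroup (Fin 2) ℂ)) (x : Site d) (i j : Fin d) :
    ((ZdGaugeConfig.plaquette (toSphereConfig U) x i j : Metric.sphere (0 : ℍ) 1) : ℍ)
      = su2Quat (ZdGaugeConfig.plaquette U x i j) := by
  rw [plaquette_toSphereConfig, coe_su2SphereEquiv]

/-- **THE WILSON PLAQUETTE ACTION IN BOTH LANGUAGES**: `1 − ½·Re tr U_p = 1 − re(q_p)`. -/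
theorem wilsonPlaquette_eq (U : ZdGaugeConfig d (Matrix.specialUnitaryGroup (Fin 2) ℂ)) (x : Site d) (i j : Fin d) :
    1 - (1 / 2 : ℝ) *
        (((ZdGaugeConfig.plaquette U x i j : Matrix.specialUnitaryGroup (Fin 2) ℂ) : Matrix (Fin 2) (Fin 2) ℂ).trace).re
      = 1 - ((ZdGaugeConfig.plaquette (toSphereConfig U) x i j : Metric.sphere (0 : ℍ) 1) : ℍ).re := by
  rw [coe_plaquette_toSphereConfig, re_trace_su2_eq_two_mul_re]
  ring

/-- For a unit quaternion, `‖Im q‖² = 1 − (re q)²`. -/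
theorem norm_im_sq_of_norm_eq_one {q : ℍ} (hq : ‖q‖ = 1) : ‖q.im‖ ^ 2 = 1 - q.re ^ 2 := by
  have h1 : Quaternion.normSq q = 1 := by rw [Quaternion.normSq_eq_norm_mul_self, hq, mul_one]
  have h2 : ‖q.im‖ ^ 2 = Quaternion.normSq q.im := by rw [Quaternion.normSq_eq_norm_mul_self, sq]
  rw [h2]
  rw [Quaternion.normSq_def'] at h1 ⊢
  simp only [Quaternion.re_im, Quaternion.imI_im, Quaternion.imJ_im, Quaternion.imK_im]
  linarith

/-- **THE SINE-CURVATURE IN TRACE LANGUAGE**: `‖E_{ij}(x)‖² = 1 − (½ Re tr U_p)²` (`= sin² θ_p` where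
`½ Re tr U_p = cos θ_p`). -/
theorem norm_curv_sq_eq (U : ZdGaugeConfig d (Matrix.specialUnitaryGroup (Fin 2) ℂ)) (x : Site d) (i j : Fin d) :
    ‖curv (toSphereConfig U) x i j‖ ^ 2
      = 1 - ((1 / 2 : ℝ) * (((ZdGaugeConfig.plaquette U x i j : Matrix.specialUnitaryGroup (Fin 2) ℂ) :
          Matrix (Fin 2) (Fin 2) ℂ).trace).re) ^ 2 := by
  have hq : ‖((ZdGaugeConfig.plaquette (toSphereConfig U) x i j : Metric.sphere (0 : ℍ) 1) : ℍ)‖ = 1 :=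
    mem_sphere_zero_iff_norm.mp (ZdGaugeConfig.plaquette (toSphereConfig U) x i j).2
  rw [curv, norm_im_sq_of_norm_eq_one hq, coe_plaquette_toSphereConfig, re_trace_su2_eq_two_mul_re]
  ring

/-- Small sine-curvature and positive trace pin the plaquette near `1`: `Re tr U_p ≥ 0` iff `re q_p ≥ 0` — the form in
which the chain's hypothesis `Re P ≥ 0` reads on `SU(2)` configurations. -/
theorem re_nonneg_iff (U : ZdGaugeConfig d (Matrix.specialUnitaryGroup (Fin 2) ℂ)) (x : Site d) (i j : Fin d) :
    0 ≤ ((ZdGaugeConfig.plaquette (toSphereConfig U) x i j : Metric.sphere (0 : ℍ) 1) : ℍ).re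
      ↔ 0 ≤ (((ZdGaugeConfig.plaquette U x i j : Matrix.specialUnitaryGroup (Fin 2) ℂ) :
          Matrix (Fin 2) (Fin 2) ℂ).trace).re := by
  rw [coe_plaquette_toSphereConfig, re_trace_su2_eq_two_mul_re]
  constructor <;> intro h <;> linarith

end Summit.QuantumFields.BalabanUV.T4Continuum.NE7b.SU2QuaternionBridge
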